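import Mathlib
import Literature.Computability.AlgebraicComplexity.StandardFamilies
import Summits.ValiantsHypothesis.ValiantsHypothesis.Theorems.ElementaryWordLengthWordLengthQPStubPerStage

/-!
# Crux `WordLengthQP` (stmt-ValiantsHypothesis-6623), line `Sketch` (eps-order-ladder) —
stub `stub_transfer`: the ε-order ladder implies the crux

The TRANSFER of the line as a theorem of the tree: if for every `c` some `per_n` has no border
width-2 program over `ℂ[ε][x]` with S-affine entries of `ε`-order `q` and length `L` both
`≤ 2^((log₂ n + c)^c)` (`EpsOrderLadder` = the open rung `stub_ladder` of the skeleton, the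
Extended Valiant Hypothesis in ladder form), then the affine elementary word length of `E₀₂(per_n)`
in `E₃(ℂ[x])` is not quasi-polynomially bounded (`WordLengthQP`, stated UNFOLDED).  Proof: a
violation at exponent `c` gives by `stub_perStage` (Bringmann–Ikenmeyer–Zuiddam 2018 §3 for the
permanent, integral form) integral border Q-words for `per_n` of shift and length
`≤ 2^((log₂ n + c')^c')`, whose letters are S-affine width-2 matrices and whose `(0,0)` entry is
`ε^M · per_n + ε^(M+1) · G₀₀` — contradicting the ladder at `c'`.
-/

-- `Summit.ValiantsHypothesis.ValiantsHypothesis.…` is the tree's mandated single-conjunct layout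
-- (Sub = Summit), so the duplicated namespace component is intended.
set_option linter.dupNamespace false

noncomputable section

open MvPolynomial

namespace Summit.ValiantsHypothesis.ValiantsHypothesis.Cruxes.WordLengthQP.EpsOrderLadder

open Literature.Computability.AlgebraicComplexity

/-- **stub_transfer**: the ε-order ladder (`stub_ladder`) implies the crux `WordLengthQP`
(unfolded). -/
theorem stub_transfer :
    (∀ c : ℕ, ∃ n : ℕ, ∀ q L : ℕ, q ≤ 2 ^ ((Nat.log 2 n + c) ^ c) →
      L ≤ 2 ^ ((Nat.log 2 n + c) ^ c) →
      ¬ (∃ ms : List (Matrix (Fin 2) (Fin 2) (MvPolynomial (Fin n × Fin n) (Polynomial ℂ))),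
          ms.length ≤ L ∧
          (∀ m ∈ ms, ∀ i j : Fin 2, (∃ b : Polynomial ℂ, m i j = MvPolynomial.C b) ∨
            (∃ (a b : Polynomial ℂ) (v : Fin n × Fin n),
              m i j = MvPolynomial.C a * MvPolynomial.X v + MvPolynomial.C b)) ∧
          ∃ G : MvPolynomial (Fin n × Fin n) (Polynomial ℂ),
            ms.prod 0 0 = MvPolynomial.C (Polynomial.X ^ q) *
                MvPolynomial.map Polynomial.C
                  (Literature.Computability.AlgebraicComplexity.perPoly (Fin n) ℂ) +
              MvPolynomial.C (Polynomial.X ^ (q + 1)) * G)) →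
    ¬ ∃ c : ℕ, ∀ n : ℕ, (∃ w : List (Fin 3 × Fin 3 × ℂ × Option (Fin n × Fin n)),
      w.length ≤ 2 ^ ((Nat.log 2 n + c) ^ c) ∧ (∀ l ∈ w, l.1 ≠ l.2.1) ∧
      (w.map (fun l => Matrix.transvection l.1 l.2.1
        (MvPolynomial.C l.2.2.1 * l.2.2.2.elim 1 MvPolynomial.X))).prod =
        Matrix.transvection (0 : Fin 3) 2
          (Literature.Computability.AlgebraicComplexity.perPoly (Fin n) ℂ)) := by
  intro hLadder
  rintro ⟨c, hc⟩
  obtain ⟨c', hc'⟩ := stub_perStage c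
  obtain ⟨n, hn⟩ := hLadder c'
  obtain ⟨w, hwlen, -, hwprod⟩ := hc n
  obtain ⟨wq, hwq, M, hM, G, hprod⟩ := hc' n ⟨w, hwlen, hwprod⟩
  refine hn M wq.length hM hwq ⟨wq.map (fun l =>
      (!![MvPolynomial.C l.1.1 * l.1.2.elim 1 MvPolynomial.X,
          MvPolynomial.C (Polynomial.X ^ l.2); MvPolynomial.C (Polynomial.X ^ l.2), 0] :
            Matrix (Fin 2) (Fin 2) (MvPolynomial (Fin n × Fin n) (Polynomial ℂ)))),
    by simp, ?_, G 0 0, ?_⟩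
  · -- the letters have S-affine entries
    intro m hm i j
    obtain ⟨l, -, rfl⟩ := List.mem_map.1 hm
    obtain ⟨⟨a, _ | v⟩, m⟩ := l
    · fin_cases i <;> fin_cases j
      · exact Or.inl ⟨a, by simp⟩
      · exact Or.inl ⟨Polynomial.X ^ m, by simp⟩
      · exact Or.inl ⟨Polynomial.X ^ m, by simp⟩
      · exact Or.inl ⟨0, by simp⟩
    · fin_cases i <;> fin_cases j
      · exact Or.inr ⟨a, 0, v, by simp⟩
      · exact Or.inl ⟨Polynomial.X ^ m, by simp⟩
      · exact Or.inl ⟨Polynomial.X ^ m, by simp⟩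
      · exact Or.inl ⟨0, by simp⟩
  · -- the `(0,0)` entry
    rw [hprod]
    simp [Matrix.add_apply, Matrix.smul_apply, smul_eq_mul]

end Summit.ValiantsHypothesis.ValiantsHypothesis.Cruxes.WordLengthQP.EpsOrderLadder
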